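import Summits.BirchSwinnertonDyer.BirchSwinnertonDyer.Theses.TangentCone
import Summits.BirchSwinnertonDyer.BirchSwinnertonDyer.Theorems.TamePinch.Negative.CMQuarticImage
import Literature.NumberTheory.EllipticCurves.ModPImageJ1728CartanProofs
import Literature.NumberTheory.EllipticCurves.DegreeConjectureAbcPrelims
import Literature.NumberTheory.EllipticCurves.SzpiroLocalDataProofs
import Mathlib.Algebra.Polynomial.SpecificDegree

/-!
# `EdgeDecay` — negative lemma: the big-image hypothesis is load-bearing (`_false_without_`, modulo a rank fact)

Crux `TangentCone.EdgeDecay` (stmt-BirchSwinnertonDyer-17608), cdisprove seat, cycle 1. The crux carries the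
hypothesis "some good ordinary prime `p₀ ≥ 5` has `ρ̄_{E,p₀}` onto" (a non-CM proxy). DROP it and the
statement is false at the CM curve `E₄₁ : y² = x³ − 41²x` (congruent number `41`; globally minimal,
`Δ = 2⁶·41⁶`) as soon as `2 ≤ E₄₁.analyticRank` is granted: the conclusion demands an admissible prime
`p ≥ 5` with `ρ̄_{E₄₁,p}` onto `GL₂(𝔽_p)`, and NO odd prime is (all squares in the image commute with the
non-scalar `[i]|E[p]`; mechanism of the landed negative 15532, imported as
`Theorems.tamePinch_not_hasSurjectiveModNGaloisRep_quartic`). The rank fact is TRUE (`41 ≡ 1 (mod 8)` congruent ⇒ positive rank, root number `+1`,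
`L(E₄₁,1) = 0` by Coates–Wiles ⇒ `ord ≥ 2`) but not constructible in the tree (`analyticRank` is the
order of `entireLFunction`; `L = L'(1) = 0` is proved for no curve), so it is a HYPOTHESIS of the theorem
`edgeDecay_false_without_bigImage_of_rank`. Moral for provers: any proof of `EdgeDecay` must USE `∃ p₀`.
-/

noncomputable section

set_option linter.dupNamespace false

open scoped Classical MatrixGroups
open Matrix Polynomial WeierstrassCurve
open Literature.NumberTheory.EllipticCurves Literature.NumberTheory.GaloisRepresentations
open Summit.BirchSwinnertonDyer.BirchSwinnertonDyer.Theses.TangentCone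

namespace Summit.BirchSwinnertonDyer.BirchSwinnertonDyer.Theorems.EdgeDecay.Negative



/-- The integral model of `E₄₁ : y² = x³ − 1681x` base-changes to the rational one. [folklore] -/
theorem baseChange_E41 :
    ((⟨0, 0, 0, -1681, 0⟩ : WeierstrassCurve ℤ).baseChange ℚ) = (⟨0, 0, 0, -1681, 0⟩ : WeierstrassCurve ℚ) := by
  simp only [WeierstrassCurve.baseChange, WeierstrassCurve.map]
  ext <;> simp

/-- `E₄₁` is globally minimal: `Δ = 2⁶·41⁶` is `12`-th-power free (Silverman AEC VII.1.1). [folklore] -/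
theorem isGloballyMinimal_E41 : (⟨0, 0, 0, -1681, 0⟩ : WeierstrassCurve ℚ).IsGloballyMinimal := by
  rw [← baseChange_E41]
  refine isGloballyMinimal_of_forall_isMinimalAt_int _ fun v ↦ ?_
  refine isMinimalAt_baseChange_int_of_not_pow_dvd_Δ ?_
  intro h
  have hΔ : (⟨0, 0, 0, -1681, 0⟩ : WeierstrassCurve ℤ).Δ = 2 ^ 6 * 41 ^ 6 := by
    simp only [WeierstrassCurve.Δ, WeierstrassCurve.b₂, WeierstrassCurve.b₄, WeierstrassCurve.b₆,
      WeierstrassCurve.b₈]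
    norm_num
  rw [hΔ] at h
  have hp := Rat.HeightOneSpectrum.prime_natGenerator v
  set q := Rat.HeightOneSpectrum.natGenerator v with hq
  have h' : q ^ 12 ∣ 2 ^ 6 * 41 ^ 6 := by exact_mod_cast h
  have hq2 : q ∣ 2 ^ 6 * 41 ^ 6 := (dvd_pow_self q (by norm_num)).trans h'
  have hq' : q = 2 ∨ q = 41 := by
    rcases (Nat.Prime.dvd_mul hp).mp hq2 with h2 | h41
    · exact Or.inl ((Nat.prime_dvd_prime_iff_eq hp Nat.prime_two).mp (hp.dvd_of_dvd_pow h2))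
    · exact Or.inr ((Nat.prime_dvd_prime_iff_eq hp (by norm_num)).mp (hp.dvd_of_dvd_pow h41))
  rcases hq' with h2 | h41
  · rw [h2] at h'; revert h'; norm_num [Nat.dvd_iff_mod_eq_zero]
  · rw [h41] at h'
    have hle : 41 ^ 12 ≤ 2 ^ 6 * 41 ^ 6 := Nat.le_of_dvd (by norm_num) h'
    norm_num at hle

/-- **`EdgeDecay` is false WITHOUT its big-image hypothesis** (modulo the true, tree-unconstructible rank
fact `2 ≤ E₄₁.analyticRank`): the displayed `Prop` is `EdgeDecay` with the hypothesis
`(∃ p₀ ≥ 5 good ordinary, ρ̄ onto) →` deleted and everything else verbatim; instantiated at the CM curve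
`E₄₁` it asks for an admissible `p ≥ 5` with surjective `ρ̄_{E₄₁,p}`, contradicting
`Theorems.tamePinch_not_hasSurjectiveModNGaloisRep_quartic`. [folklore] -/
theorem edgeDecay_false_without_bigImage_of_rank
    (h41 : 2 ≤ (⟨0, 0, 0, -1681, 0⟩ : WeierstrassCurve ℚ).analyticRank) :
    ¬ (∀ (W : WeierstrassCurve ℚ) [W.IsElliptic] [W.IsGloballyMinimal], 2 ≤ W.analyticRank →
      ∃ (_ : NeZero (W.conductorNorm ℤ)) (p : ℕ) (_ : Fact p.Prime), 5 ≤ p ∧ W.HasGoodReductionAtPrime p ∧ ¬ (p : ℤ) ∣ W.frobeniusTrace p ∧ ¬ (p : ℤ) ∣ (W.frobeniusTrace p) ^ 2 - 1 ∧ W.HasSurjectiveModNGaloisRep p ∧ (∀ (M : ℕ) (_ : NeZero M) (g : CuspForm (CongruenceSubgroup.Gamma0 M) 2) (ι : Literature.NumberTheory.EllipticCurves.ModularForms.coeffField g →+* PadicAlgCl p), M ∣ W.conductorNorm ℤ * p → Literature.NumberTheory.EllipticCurves.ModularForms.IsNewform0 g → ‖ι ⟨(UpperHalfPlane.qExpansion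 1 ⇑g).coeff p, Literature.NumberTheory.EllipticCurves.ModularForms.coeff_mem_coeffField g p⟩‖ = 1 → (∀ ℓ : ℕ, ℓ.Prime → ¬ ℓ ∣ W.conductorNorm ℤ * p → ‖ι ⟨(UpperHalfPlane.qExpansion 1 ⇑g).coeff ℓ, Literature.NumberTheory.EllipticCurves.ModularForms.coeff_mem_coeffField g ℓ⟩ - ((W.frobeniusTrace ℓ : ℤ) : PadicAlgCl p)‖ < 1) → M = W.conductorNorm ℤ ∧ ∀ n : ℕ, (UpperHalfPlane.qExpansion 1 ⇑g).coeff n = ((W.LFunction n : ℤ) : ℂ)) ∧ ∃ (a b : ℕ), 0 < b ∧ 2 * a < b ∧ ∀ J : ℕ, ∃ C : ℕ, ∀ m : ℕ, ∃ (k : ℤ) (g : CuspForm (CongruenceSubgroup.Gamma0 (W.conductorNorm ℤ)) k) (ι : Literature.NumberTheory.EllipticCurves.ModularForms.coeffField g →+* PadicAlgCl p) (s : ℕ), (2 * b * (p - 1) * p ^ m : ℤ) ∣ (k - 2) ∧ (2 * J + 3 : ℤ) ≤ k ∧ (b : ℤ) * ((s : ℤ) - 1) = a * (k - 2) ∧ Literature.NumberTheory.EllipticCurves.ModularForms.IsNewform0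 g ∧ ‖ι ⟨(UpperHalfPlane.qExpansion 1 ⇑g).coeff p, Literature.NumberTheory.EllipticCurves.ModularForms.coeff_mem_coeffField g p⟩‖ = 1 ∧ (∀ ℓ : ℕ, ℓ.Prime → ¬ ℓ ∣ W.conductorNorm ℤ * p → ‖ι ⟨(UpperHalfPlane.qExpansion 1 ⇑g).coeff ℓ, Literature.NumberTheory.EllipticCurves.ModularForms.coeff_mem_coeffField g ℓ⟩ - ((W.frobeniusTrace ℓ : ℤ) : PadicAlgCl p)‖ < 1) ∧ ∀ (j : ℕ), Odd j → 3 ≤ j → j ≤ 2 * J + 1 → ∃ hR : (∫ t in Set.Ioi (0 : ℝ), ((t : ℂ) ^ (s - 1)) * g (UpperHalfPlane.ofComplex ((t : ℂ) * Complex.I))) / (∫ t in Set.Ioi (0 : ℝ), ((t : ℂ) ^ (j - 1)) * g (UpperHalfPlane.ofComplex ((t : ℂ) * Complex.I))) ∈ Literature.NumberTheory.EllipticCurves.ModularForms.coeffField g, 1 ≤ ‖ι ⟨_, hR⟩‖ * (p : ℝ) ^ (W.analyticRank * (m + 1) + C)) := by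
  intro h
  haveI : (⟨0, 0, 0, -1681, 0⟩ : WeierstrassCurve ℚ).IsElliptic := isElliptic_quartic (by norm_num)
  haveI : (⟨0, 0, 0, -1681, 0⟩ : WeierstrassCurve ℚ).IsGloballyMinimal := isGloballyMinimal_E41
  obtain ⟨-, p, hp, h5, -, -, -, hsurj, -⟩ := h (⟨0, 0, 0, -1681, 0⟩ : WeierstrassCurve ℚ) h41
  haveI := hp
  exact Theorems.tamePinch_not_hasSurjectiveModNGaloisRep_quartic (D := -1681) (by norm_num) p (by omega) hsurj

end Summit.BirchSwinnertonDyer.BirchSwinnertonDyer.Theorems.EdgeDecay.Negative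

end
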